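import Literature.AnabelianGeometry.AbsoluteAnabelian.AbsTopIII.Thm19DictionaryBridgePoints
import Literature.AnabelianGeometry.AbsoluteAnabelian.AbsTopIII.Thm19KummerTowerBridgeProofs
import Literature.AnabelianGeometry.AbsoluteAnabelian.AbsTopIII.Thm19BaseChangeCoefficients
import Literature.AnabelianGeometry.AbsoluteAnabelian.AbsTopIII.Thm19KummerContainerDirected
import Literature.AnabelianGeometry.AbsoluteAnabelian.AbsTopIII.Thm19CuspidalDegreeZHat
import Literature.AnabelianGeometry.AbsoluteAnabelian.AbsTopIII.Thm19bPresentationsProofs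
import Literature.AnabelianGeometry.AbsoluteAnabelian.AbsTopIII.KummerCurveLawsAPI
import HarnessLib

/-!
# [AbsTopIII] Thm. 1.9 (e): the ORDER dictionary of a saturated tagged system, derived from the per-curve
# laws (proof-only; part 2 of the (e)-bridge: `HasOrderAt` versus `ord` at the named place)

Mochizuki, *Topics in Absolute Anabelian Geometry III*, §1, Theorem 1.9 (e), manuscript p. 38, with
Prop. 1.3 (b) p. 30 ("`V_X := {ord_x : K_X^× ↠ ℤ}_{x ∈ X(k)}`") and Prop. 1.6 (iii) p. 35 (lit key
`paper:url-5493eb38cbb7`).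

Cell abc-iut, sub-DAG `plan/L4/SUBDAG-AbsTopIII-Thm19.md`, row Thm19.e.r11; the (e)-BRIDGE of
abc-iut-L4-lead RULING #5j (3), part (e2) ORDERS, over the six-layer law tower `PlacedKummerModelV2`.  For a
regular unit `g₀` of a level `V_{j₀}` descending to `a ∈ K_{Z_NF}^×` (`σ_{j₀}(g₀) = a` in `K_{Z_{k̄}}`), the
container-level predicate `HasOrderAt (κ(g₀)) x n` of abc-iut-w5-d213's extracted triple (∃ a level, a cusp
over `x`, a system of cyclotome presentations and a representing class of integral cuspidal degree `n`)
holds IFF `n = ε · ord_v(a)` at the place `v` named by `x`, `ε = degSign` being the orientation sign of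
the Kummer-degree law (D).  Ingredients: a level where `x` has become a cusp (cofinality tags, layer VI
fibre law), presentations at every level (abc-iut-L4-t1's `nonempty_cuspSyncPresentation` from the four
Prop. 1.4 named facts), the degree of a Kummer class (law (D), `hasCuspidalDegree_kummer`), the order at the
named place (layer III `ord_nfPlace`); and conversely the TRANSPORT of degrees along transitions (layer V
(D-transport)), whose hypothesis is obtained from equality in the container via the naturality of the
Kummer classes (`kummer_naturality_of_factorization`) and the injectivity of the change of coefficients
along base-change legs (abc-iut-w5-d099), the lifting of cusps (layer VI), and the UNIQUENESS of integral
degrees (abc-iut-L4-t4's `HasCuspidalDegree.unique'`).  All theorems; no definition, no new named fact;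
nothing here bears on [IUTchIII] Cor. 3.12.
-/

noncomputable section

open CategoryTheory
open scoped Pointwise

namespace Literature.AnabelianGeometry.AbsoluteAnabelian.AbsTopIII

open Literature.NumberTheory.DiophantineGeometry
open Literature.NumberTheory.DiophantineGeometry.AlgFunctionField

universe u

namespace PlacedKummerModelV2

variable (N : PlacedKummerModelV2.{u}) {Z : N.Curve} {ι : Type u} [Preorder ι]
  (S : CurveModel.NFComplementSystem N.toCurveModel Z ι)
  (T : CurveModel.NFComplementSystem.GeomTags N.toDescentKummerModel S)

/-- `g • (g' • K) = (g g') • K` (private local copy). [cite: MochizukiAbsTopIII2015, Thm 1.9 (a) p.37] -/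
private theorem conj_smul_conj_smul' {G : Type*} [Group G] (g g' : G) (K : Subgroup G) :
    MulAut.conj g • MulAut.conj g' • K = MulAut.conj (g * g') • K := by
  rw [← mul_smul, ← map_mul]

/-- `f(g K g⁻¹) = f(g) f(K) f(g)⁻¹` (private local copy). [cite: MochizukiAbsTopIII2015, Thm 1.9 (a) p.37] -/
private theorem map_conj_smul' {G H : Type*} [Group G] [Group H] (f : G →* H) (g : G) (K : Subgroup G) :
    (MulAut.conj g • K).map f = MulAut.conj (f g) • K.map f := by
  rw [Subgroup.pointwise_smul_def, Subgroup.pointwise_smul_def, Subgroup.map_map, Subgroup.map_map]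
  congr 1
  ext x
  simp [MulAut.conj_apply, map_mul, map_inv]

/-! ### `LiesOver` along composites of transitions -/

/-- `LiesOver` composes: a subgroup of level `k` lying over `w ∈ V_j` whose decomposition group lies over
`x ∈ V_i` lies over `x` (`trans_trans`). [cite: MochizukiAbsTopIII2015, Thm 1.9 (a) p.37] -/
theorem liesOver_trans {i j k : ι} (hij : i ≤ j) (hjk : j ≤ k) (D : Subgroup (N.ext (S.V k)).arith)
    (w : N.Point (S.V j)) (x : N.Point (S.V i)) (hD : N.LiesOver S hjk D w)
    (hw : N.LiesOver S hij (N.decomp (S.V j) w) x) : N.LiesOver S (hij.trans hjk) D x := by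
  obtain ⟨g, hg⟩ := hD
  obtain ⟨g', hg'⟩ := hw
  refine ⟨(S.trans hij).arith.toMonoidHom g * g', ?_⟩
  rw [S.trans_trans hij hjk, FundamentalExtension.comp_arith]
  change Subgroup.map ((S.trans hij).arith.toMonoidHom.comp (S.trans hjk).arith.toMonoidHom) D ≤ _
  rw [← Subgroup.map_map, ← conj_smul_conj_smul']
  refine le_trans (Subgroup.map_mono hg) ?_
  rw [map_conj_smul']
  exact Subgroup.pointwise_smul_le_pointwise_smul_iff.mpr hg'

/-! ### A level at which a given NF-point has become a cusp -/

/-- **Every NF-point of a level becomes a cusp at some later level, above any prescribed level**: for a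
rational NF-point `x ∈ V_i` and a level `j₀` there are a level `j ≥ i, j₀`, a cusp `c` of `V_j` and the
point `y ∈ Z_j` it fills, with `y ↦ x` under `Z_j → Z_i` and `D_c` lying over `x` (cofinality tags
`cofinal`-free: `removed_cofinal`; layer VI fibre law; layer IV `cuspPt_comp_some`).
[cite: MochizukiAbsTopIII2015, Thm 1.9 (d) p.37] -/
theorem exists_cusp_level [IsDirectedOrder ι] {i : ι} (x : N.Point (S.V i)) (hx : N.IsNFPoint (S.V i) x)
    (j₀ : ι) :
    ∃ (j : ι) (hij : i ≤ j) (_ : j₀ ≤ j) (c : (N.cusps (S.V j)).Cusp) (y : N.Point (S.Zb j)),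
      N.cuspPt (S.isOpen j) c = some y ∧ N.bcPt (T.hZZ hij) y = N.ptRes (S.isOpen i) x ∧
        N.LiesOver S hij ((N.cusps (S.V j)).Dcusp c) x := by
  obtain ⟨j₁, hij₁, hj₀j₁⟩ := exists_ge_ge i j₀
  obtain ⟨p₁, hp₁⟩ := N.bcPt_surjective (T.hZZ hij₁) (N.ptRes (S.isOpen i) x)
  obtain ⟨w₀, hw₀, hw₀x⟩ :=
    N.exists_pt_bc_open (T.hWV hij₁) (T.hZZ hij₁) (S.isOpen i) (T.hWZ hij₁) x p₁ hp₁
  rcases N.exists_ptRes_or_cuspPt (T.hVW hij₁) w₀ with ⟨w, hw⟩ | ⟨c₁, hc₁⟩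
  · -- `x` is still a point `w` of `V_{j₁}`: remove it at a later level
    have himg : N.bcPt (T.hWV hij₁) (N.ptRes (T.hVW hij₁) w) = x := by rw [hw, hw₀x]
    have hwNF : N.IsNFPoint (S.V j₁) w := by
      have h1 : N.IsNFPoint (S.Zb i) (N.ptRes (S.isOpen i) x) :=
        (N.isNFPoint_ptRes (S.isOpen i) (S.isNFCurve i) x).2 hx
      rw [← N.isNFPoint_ptRes (S.isOpen j₁) (S.isNFCurve j₁) w,
        N.isNFPoint_bcPt (T.hZZ hij₁) (N.isNFCurve_of_isCofiniteOpen (S.isOpen i) (S.isNFCurve i)),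
        ← N.ptRes_imgPt S T hij₁ w, himg]
      exact h1
    obtain ⟨j, hj₁j, c, w', hc, hw'⟩ := T.removed_cofinal j₁ w hwNF
    refine ⟨j, hij₁.trans hj₁j, hj₀j₁.trans hj₁j, c, N.ptRes (T.hWZ hj₁j) w',
      N.cuspPt_comp_some (T.hVW hj₁j) (T.hWZ hj₁j) (S.isOpen j) c w' hc, ?_, ?_⟩
    · rw [← N.bcPt_comp (T.hZZ hj₁j) (T.hZZ hij₁) (T.hZZ (hij₁.trans hj₁j)),
        ← N.bcPt_ptRes (T.hWV hj₁j) (T.hZZ hj₁j) (S.isOpen j₁) (T.hWZ hj₁j), hw',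
        ← N.ptRes_imgPt S T hij₁ w, himg]
    · refine N.liesOver_trans S hij₁ hj₁j _ w x ?_ ?_
      · rw [← hw']
        exact N.liesOver_dcusp_of_cuspPt S T hj₁j c w' hc
      · rw [← himg]
        exact N.liesOver_decomp_imgPt S T hij₁ w
  · -- `x` is already filled by the cusp `c₁` of `V_{j₁}`
    refine ⟨j₁, hij₁, hj₀j₁, c₁, p₁, ?_, hp₁, ?_⟩
    · rw [← hw₀]
      exact N.cuspPt_comp_some (T.hVW hij₁) (T.hWZ hij₁) (S.isOpen j₁) c₁ w₀ hc₁
    · rw [← hw₀x]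
      exact N.liesOver_dcusp_of_cuspPt S T hij₁ c₁ w₀ hc₁

/-! ### Cusps lift along transitions -/

/-- **Cusps lift along the transitions of a tagged system**: for `j ≤ k` and a cusp `c` of `V_j` there is a
cusp `c′` of `V_k` over it, in the form required by layer V's (D-transport): `c′` is a cusp of `W_{jk}`
(`cuspPt = none`, layer IV `exists_cuspRes_eq` / `decomp_cuspRes`) lying over `c` along the base-change
leg (layer VI `exists_cusp_above_bc`). [cite: MochizukiAbsTopIII2015, Thm 1.9 (a) p.37] -/
theorem exists_cusp_above {j k : ι} (h : j ≤ k) (c : (N.cusps (S.V j)).Cusp) :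
    ∃ (c' : (N.cusps (S.V k)).Cusp) (_ : N.cuspPt (T.hVW h) c' = none) (g : (N.ext (S.V j)).arith),
      ((N.cusps (S.V k)).Dcusp c').map (N.res (T.hVW h) ≫ N.bc (T.hWV h)).arith.toMonoidHom ≤
        MulAut.conj g • (N.cusps (S.V j)).Dcusp c := by
  obtain ⟨cW, g, hcW⟩ := N.exists_cusp_above_bc (T.hWV h) c
  obtain ⟨c', hc', hres⟩ := N.exists_cuspRes_eq (T.hVW h) cW
  refine ⟨c', hc', g, ?_⟩
  rw [FundamentalExtension.comp_arith]
  change Subgroup.map ((N.bc (T.hWV h)).arith.toMonoidHom.comp (N.res (T.hVW h)).arith.toMonoidHom) _ ≤ _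
  rw [← Subgroup.map_map, N.decomp_cuspRes (T.hVW h) c' hc', hres]
  exact hcW

/-! ### From equality in the container to the transport hypothesis -/

/-- The commuting square of a tagged transition over the base-change leg of the compactifications:
`(V_k ⊆ W → V_j) ≫ (V_j ⊆ Z_j) = (V_k ⊆ Z_k) ≫ (Z_k → Z_j)`.
[cite: MochizukiAbsTopIII2015, Thm 1.9 (d) p.37] -/
theorem trans_sq {j k : ι} (h : j ≤ k) :
    (N.res (T.hVW h) ≫ N.bc (T.hWV h)) ≫ N.res (S.isOpen j) = N.res (S.isOpen k) ≫ N.bc (T.hZZ h) := by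
  rw [Category.assoc, N.bc_res_comm (T.hWV h) (T.hZZ h) (S.isOpen j) (T.hWZ h), ← Category.assoc,
    N.res_comp (T.hVW h) (T.hWZ h) (S.isOpen k)]

/-- **Equality after transition yields the transport relation**: if the class `η′` of level `j` and the
class `κ` of level `k ≥ j` agree in `H¹(Π_{V_k}, M_Z)` after transition / change of coefficients, then
`(M_{Z_k} ⥲ M_{Z_j})_* κ` is the pull-back of `η′` along the transition — the hypothesis of layer V's
(D-transport) (Pull/Push functoriality; injectivity of the change of coefficients along the base-change leg
`Z_j → Z`, abc-iut-w5-d099). [cite: MochizukiAbsTopIII2015, Thm 1.9 (d) p.37] -/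
theorem push_eq_pull_of_transition_eq {j k : ι} (h : j ≤ k)
    (η' : cyclotomeModH1 (N.res (S.isOpen j)) ZHatCoeff.{u})
    (κ : cyclotomeModH1 (N.res (S.isOpen k)) ZHatCoeff.{u})
    (hk : S.transition j k h (N.pushToZ S j η') = N.pushToZ S k κ) :
    (cyclotomeModH1Push ZHatCoeff.{u} (N.res (S.isOpen k)) (N.bc (T.hZZ h))).hom κ =
      (cyclotomeModH1Pull ZHatCoeff.{u} (N.res (T.hVW h) ≫ N.bc (T.hWV h)) (N.res (S.isOpen j))
        (N.res (S.isOpen k) ≫ N.bc (T.hZZ h)) (N.trans_sq S T h)).hom η' := by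
  -- generalize the leg `Z_k → Z` and the transition to variables and substitute their factorizations
  have key : ∀ (bk : N.ext (S.Zb k) ⟶ N.ext Z) (hbk : bk = N.bc (T.hZZ h) ≫ S.bc j)
      (t : N.ext (S.V k) ⟶ N.ext (S.V j)) (ht : t = N.res (T.hVW h) ≫ N.bc (T.hWV h))
      (htc : t ≫ (N.res (S.isOpen j) ≫ S.bc j) = N.res (S.isOpen k) ≫ bk),
      (cyclotomeModH1Pull ZHatCoeff.{u} t (N.res (S.isOpen j) ≫ S.bc j) (N.res (S.isOpen k) ≫ bk)
          htc).hom ((cyclotomeModH1Push ZHatCoeff.{u} (N.res (S.isOpen j)) (S.bc j)).hom η') =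
        (cyclotomeModH1Push ZHatCoeff.{u} (N.res (S.isOpen k)) bk).hom κ →
      (cyclotomeModH1Push ZHatCoeff.{u} (N.res (S.isOpen k)) (N.bc (T.hZZ h))).hom κ =
        (cyclotomeModH1Pull ZHatCoeff.{u} (N.res (T.hVW h) ≫ N.bc (T.hWV h)) (N.res (S.isOpen j))
          (N.res (S.isOpen k) ≫ N.bc (T.hZZ h)) (N.trans_sq S T h)).hom η' := by
    intro bk hbk t ht htc hyp
    subst hbk
    subst ht
    have sq := N.trans_sq S T h
    -- decompose the push along `bc hZZ ≫ bc j`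
    have e1 := congrArg (fun φ => φ.hom κ)
      (cyclotomeModH1Push_comp ZHatCoeff.{u} (N.res (S.isOpen k)) (N.bc (T.hZZ h)) (S.bc j))
    -- commute the pull-back along the transition past the push along `bc j`
    have htc' : (N.res (T.hVW h) ≫ N.bc (T.hWV h)) ≫ (N.res (S.isOpen j) ≫ S.bc j) =
        (N.res (S.isOpen k) ≫ N.bc (T.hZZ h)) ≫ S.bc j := by
      rw [← Category.assoc, sq]
    have e2 := congrArg (fun φ => φ.hom η')
      (cyclotomeModH1Pull_push_comm ZHatCoeff.{u} (N.res (T.hVW h) ≫ N.bc (T.hWV h))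
        (N.res (S.isOpen j)) (N.res (S.isOpen k) ≫ N.bc (T.hZZ h)) sq (S.bc j) htc')
    simp only [TopModuleCat.hom_comp, ContinuousLinearMap.comp_apply] at e1 e2
    apply cyclotomeModH1Push_injective_of_isBaseChange ZHatCoeff.{u}
      (N.res (S.isOpen k) ≫ N.bc (T.hZZ h)) (S.isBaseChange j)
    exact e1.trans (hyp.symm.trans e2.symm)
  refine key (S.bc k) (T.bc_trans h).symm (S.trans h) (T.trans_eq h) (S.trans_comm h) ?_
  exact hk

/-- `LiesOver` along a containment at an intermediate level: if `D ≤ Π_{V_k}` maps into a conjugate of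
`D′ ≤ Π_{V_j}` and `D′` lies over `x ∈ V_i`, then `D` lies over `x`.
[cite: MochizukiAbsTopIII2015, Thm 1.9 (a) p.37] -/
theorem liesOver_of_map_le {i j k : ι} (hij : i ≤ j) (hjk : j ≤ k) (D : Subgroup (N.ext (S.V k)).arith)
    (D' : Subgroup (N.ext (S.V j)).arith) (x : N.Point (S.V i)) (g : (N.ext (S.V j)).arith)
    (hD : D.map (S.trans hjk).arith.toMonoidHom ≤ MulAut.conj g • D') (hD' : N.LiesOver S hij D' x) :
    N.LiesOver S (hij.trans hjk) D x := by
  obtain ⟨g', hg'⟩ := hD'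
  refine ⟨(S.trans hij).arith.toMonoidHom g * g', ?_⟩
  rw [S.trans_trans hij hjk, FundamentalExtension.comp_arith]
  change Subgroup.map ((S.trans hij).arith.toMonoidHom.comp (S.trans hjk).arith.toMonoidHom) D ≤ _
  rw [← Subgroup.map_map, ← conj_smul_conj_smul']
  refine le_trans (Subgroup.map_mono hD) ?_
  rw [map_conj_smul']
  exact Subgroup.pointwise_smul_le_pointwise_smul_iff.mpr hg'

/-! ### Representatives of an element of `K_{Z_NF}^×` along the tower -/

section Rep

variable {j₀ : ι} (g₀ : N.regularUnits (S.V j₀)) (u : (N.NFFunctionField Z)ˣ)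

/-- Restricting a representative along a transition gives a representative (coherence of the
function-field tower, `toGeom_fieldRes_coherent`). [cite: MochizukiAbsTopIII2015, Thm 1.9 (d) p.37] -/
theorem rep_res {j : ι} (h : j₀ ≤ j)
    (hrep : letI := N.instGeomField Z;
      N.toGeom (T.hZb j₀) ((N.fieldRes (S.isOpen j₀)).symm ((g₀ : (N.FunctionField (S.V j₀))ˣ) : _)) =
        N.nfToGeom Z (u : N.NFFunctionField Z)) :
    letI := N.instGeomField Z;
      N.toGeom (T.hZb j) ((N.fieldRes (S.isOpen j)).symm
        (((Additive.toMul ((N.unitRes (T.hVW h)).comp (N.bcUnitRes (T.hWV h)) (Additive.ofMul g₀)) :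
          N.regularUnits (S.V j)) : (N.FunctionField (S.V j))ˣ) : _)) =
        N.nfToGeom Z (u : N.NFFunctionField Z) := by
  letI := N.instGeomField Z
  rw [← hrep]
  exact N.toGeom_fieldRes_coherent (T.hVW h) (T.hWZ h) (S.isOpen j) (T.hWV h) (T.hZZ h) (S.isOpen j₀)
    (T.hZb j₀) (T.hZb j) ((g₀ : (N.FunctionField (S.V j₀))ˣ) : N.FunctionField (S.V j₀))

/-- NATURALITY: the transition of the level Kummer class of `g₀` is the level Kummer class of its
restriction (`kummer_naturality_of_factorization`). [cite: MochizukiAbsTopIII2015, Thm 1.9 (d) p.38] -/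
theorem transition_kummerLevel {j : ι} (h : j₀ ≤ j) :
    S.transition j₀ j h (N.kummerLevel S j₀ (Additive.ofMul g₀)) =
      N.kummerLevel S j ((N.unitRes (T.hVW h)).comp (N.bcUnitRes (T.hWV h)) (Additive.ofMul g₀)) :=
  N.kummer_naturality_of_factorization (T.hVW h) (T.hWZ h) (S.isOpen j) (T.hWV h) (T.hZZ h)
    (S.isOpen j₀) (S.isProper j₀) (S.isProper j) (S.bc j₀) (T.bc_trans h).symm (T.trans_eq h)
    (S.trans_comm h) g₀

/-- The Kummer class in the container does not change along the tower.
[cite: MochizukiAbsTopIII2015, Thm 1.9 (d) p.38] -/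
theorem kummerToContainer_res {j : ι} (h : j₀ ≤ j) :
    N.kummerToContainer S j ((N.unitRes (T.hVW h)).comp (N.bcUnitRes (T.hWV h)) (Additive.ofMul g₀)) =
      N.kummerToContainer S j₀ (Additive.ofMul g₀) := by
  rw [N.kummerToContainer_apply, N.kummerToContainer_apply, ← N.transition_kummerLevel S T g₀ h,
    S.toContainer_transition h]

end Rep

/-! ### The order dictionary -/

section Orders

variable [IsDirectedOrder ι] (h154 : Rmk_1_5_4_i.{u}) (h14i : N.Prop_1_4_i) (h14 : N.Prop_1_4_i')
  (h142 : N.Prop_1_4_ii) (hT14 : N.Prop_1_4_ii_transgression) (hZ : N.IsThm19dInput Z)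
  {j₀ : ι} (g₀ : N.regularUnits (S.V j₀)) (u : (N.NFFunctionField Z)ˣ)
  (hrep : letI := N.instGeomField Z;
    N.toGeom (T.hZb j₀) ((N.fieldRes (S.isOpen j₀)).symm ((g₀ : (N.FunctionField (S.V j₀))ˣ) : _)) =
      N.nfToGeom Z (u : N.NFFunctionField Z))
  (a : N.NFPointIndex S)

include h154 h14i h14 h142 hT14 hZ hrep

omit h154 hZ in
/-- **The Kummer class of a representative of `u ∈ K_{Z_NF}^×` has order `ε · ord_v(u)` at every index
naming `v`** (`ε = degSign`): at a level where the index has become a cusp `c` filling `y`, with a system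
of cyclotome presentations (abc-iut-L4-t1, from the four Prop. 1.4 named facts), the Kummer class has
integral degree `ε · ord_y` at `c` (law (D)), and `ord_y = ord_v(u)` (layer III `ord_nfPlace`).
[cite: MochizukiAbsTopIII2015, Thm 1.9 (e) p.38] -/
theorem hasOrderAt_rep :
    N.HasOrderAt S (N.kummerToContainer S j₀ (Additive.ofMul g₀)) a
      ((N.degSign : ℤ) * @PlaceOver.ord _ (N.NFFunctionField Z) _ _ (N.nfAlgebra Z)
        (N.nfPlace (T.hZb a.1) (N.ptRes (S.isOpen a.1) a.2.1)
          ((N.isNFPoint_ptRes (S.isOpen a.1) (S.isNFCurve a.1) a.2.1).2 a.2.2.1)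
          ((N.isRationalPt_ptRes (S.isOpen a.1) a.2.1).2 a.2.2.2)) (u : N.NFFunctionField Z)) := by
  letI := N.instGeomField Z
  obtain ⟨j, haj, hj₀j, c, y, hc, hy, hlies⟩ := N.exists_cusp_level S T a.2.1 a.2.2.1 j₀
  obtain ⟨P⟩ := N.nonempty_cuspSyncPresentation h14i h14 h142 hT14 (S.isOpen j) (S.isScheme j).1
    (S.isScheme j).2 (S.isProper j) (S.cuspsRational j)
  set gj : N.regularUnits (S.V j) :=
    Additive.toMul ((N.unitRes (T.hVW hj₀j)).comp (N.bcUnitRes (T.hWV hj₀j)) (Additive.ofMul g₀)) with hgj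
  refine ⟨j, haj, c, P, N.kummerAddHom (S.isOpen j) (S.isProper j) (Additive.ofMul gj), hlies, ?_, ?_⟩
  · rw [← N.kummerToContainer_res S T g₀ hj₀j]
    rfl
  · obtain ⟨hy1, hy2, hplace⟩ := N.nfPlace_eq_of_bcPt_eq S T haj a.2.1 a.2.2.1 a.2.2.2 y hy
    have hrepj := N.rep_res S T g₀ u hj₀j hrep
    have hord := N.ord_nfPlace (T.hZb j) y hy1 hy2
      (Units.map (N.fieldRes (S.isOpen j)).symm.toRingHom.toMonoidHom (gj : (N.FunctionField (S.V j))ˣ))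
      (u : N.NFFunctionField Z) (by rw [Units.coe_map]; exact hrepj)
    rw [hplace, hord]
    exact N.hasCuspidalDegree_kummer (S.isProper j) P gj c y hc

/-- **Conversely, every order read in the container IS `ε · ord_v(u)`**: a class `η′` of some level
representing the Kummer class of `u` with integral degree `n` at a cusp over the index agrees with a level
Kummer class of `u` after transition (directed limit), whence — by the TRANSPORT of degrees along the
transition (layer V (D-transport); its hypothesis from `push_eq_pull_of_transition_eq`), the Kummer degree
(law (D)) and the UNIQUENESS of integral degrees (abc-iut-L4-t4) — `n = ε · ord_y = ε · ord_v(u)`.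
[cite: MochizukiAbsTopIII2015, Thm 1.9 (e) p.38] -/
theorem eq_of_hasOrderAt_rep (n : ℤ)
    (hn : N.HasOrderAt S (N.kummerToContainer S j₀ (Additive.ofMul g₀)) a n) :
    n = (N.degSign : ℤ) * @PlaceOver.ord _ (N.NFFunctionField Z) _ _ (N.nfAlgebra Z)
        (N.nfPlace (T.hZb a.1) (N.ptRes (S.isOpen a.1) a.2.1)
          ((N.isNFPoint_ptRes (S.isOpen a.1) (S.isNFCurve a.1) a.2.1).2 a.2.2.1)
          ((N.isRationalPt_ptRes (S.isOpen a.1) a.2.1).2 a.2.2.2)) (u : N.NFFunctionField Z) := by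
  letI := N.instGeomField Z
  obtain ⟨j', haj', c', P', η', hlies, hcont, hdeg⟩ := hn
  -- a common level where the two classes agree
  obtain ⟨k, hj'k, hj₀k, hk⟩ := (S.toContainer_eq_toContainer_iff _ _).1 hcont
  set gk : N.regularUnits (S.V k) :=
    Additive.toMul ((N.unitRes (T.hVW hj₀k)).comp (N.bcUnitRes (T.hWV hj₀k)) (Additive.ofMul g₀)) with hgk
  have hk' : S.transition j' k hj'k (N.pushToZ S j' η') =
      N.pushToZ S k (N.kummerAddHom (S.isOpen k) (S.isProper k) (Additive.ofMul gk)) := by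
    rw [hk]
    exact N.transition_kummerLevel S T g₀ hj₀k
  have hpush := N.push_eq_pull_of_transition_eq S T hj'k η' _ hk'
  -- a cusp of `V_k` over `c'`, a presentation at level `k`, transport of the degree
  obtain ⟨ck, hck0, g, hck⟩ := N.exists_cusp_above S T hj'k c'
  obtain ⟨Pk⟩ := N.nonempty_cuspSyncPresentation h14i h14 h142 hT14 (S.isOpen k) (S.isScheme k).1
    (S.isScheme k).2 (S.isProper k) (S.cuspsRational k)
  have hdegk : CurveModel.HasCuspidalDegree Pk
      (N.kummerAddHom (S.isOpen k) (S.isProper k) (Additive.ofMul gk)) ck n :=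
    (N.hasCuspidalDegree_transport (T.hVW hj'k) (T.hWV hj'k) (S.isOpen k) (T.hZZ hj'k) (S.isOpen j')
      (N.trans_sq S T hj'k) P' Pk c' ck g hck hck0 η' _ n hpush).1 hdeg
  -- the Kummer degree at `ck` and uniqueness
  obtain ⟨yk, hyk⟩ := Option.isSome_iff_exists.mp (N.cuspPt_isSome (S.isOpen k) (S.isProper k) ck)
  have hdegK := N.hasCuspidalDegree_kummer (S.isProper k) Pk gk ck yk hyk
  have hnm := CurveModel.HasCuspidalDegree.unique' Pk hdegk hdegK
  -- `ck` lies over the index; the point it fills names the index' place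
  have hliesk : N.LiesOver S (haj'.trans hj'k) ((N.cusps (S.V k)).Dcusp ck) a.2.1 := by
    refine N.liesOver_of_map_le S haj' hj'k _ _ a.2.1 g ?_ hlies
    rw [T.trans_eq hj'k]
    exact hck
  have hyk' := N.bcPt_eq_of_dcusp_liesOver S T h154 h14i hZ (haj'.trans hj'k) ck a.2.1 hliesk yk hyk
  obtain ⟨hy1, hy2, hplace⟩ := N.nfPlace_eq_of_bcPt_eq S T (haj'.trans hj'k) a.2.1 a.2.2.1 a.2.2.2 yk hyk'
  have hrepk := N.rep_res S T g₀ u hj₀k hrep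
  have hord := N.ord_nfPlace (T.hZb k) yk hy1 hy2
    (Units.map (N.fieldRes (S.isOpen k)).symm.toRingHom.toMonoidHom (gk : (N.FunctionField (S.V k))ˣ))
    (u : N.NFFunctionField Z) (by rw [Units.coe_map]; exact hrepk)
  rw [hplace, hord]
  exact hnm

/-- **The order dictionary (e2) for a represented element**: `HasOrderAt (κ(g₀)) a n ↔ n = ε · ord_v(u)`.
[cite: MochizukiAbsTopIII2015, Thm 1.9 (e) p.38] -/
theorem hasOrderAt_rep_iff (n : ℤ) :
    N.HasOrderAt S (N.kummerToContainer S j₀ (Additive.ofMul g₀)) a n ↔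
      n = (N.degSign : ℤ) * @PlaceOver.ord _ (N.NFFunctionField Z) _ _ (N.nfAlgebra Z)
        (N.nfPlace (T.hZb a.1) (N.ptRes (S.isOpen a.1) a.2.1)
          ((N.isNFPoint_ptRes (S.isOpen a.1) (S.isNFCurve a.1) a.2.1).2 a.2.2.1)
          ((N.isRationalPt_ptRes (S.isOpen a.1) a.2.1).2 a.2.2.2)) (u : N.NFFunctionField Z) :=
  ⟨N.eq_of_hasOrderAt_rep S T h154 h14i h14 h142 hT14 hZ g₀ u hrep a n, fun h =>
    h ▸ N.hasOrderAt_rep S T h14i h14 h142 hT14 g₀ u hrep a⟩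

end Orders

end PlacedKummerModelV2

end Literature.AnabelianGeometry.AbsoluteAnabelian.AbsTopIII
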